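import Summits.Ventures.HSemireg.WedgeWeilCarrier

/-!
# Venture HSemireg — THEOREM R (Weil rank) ON THE p4 CARRIER, the assembled statements: `ContractionSpan.span` of
# `f(Θ) + a·w₊ + b·w₋` in an adapted frame (signature `(p, N - p)` and Weil type `(n, n)`, degree 2 and every degree)

HONEST FRAMING. Part of the Lean index of the computation cell `pub-hsemireg` (seat p4 gen 3; FORMULA-N PART B §N.4 / §N.5).
Finite-dimensional exterior algebra over a field ONLY: no variety, no cohomology theory, no semiregularity map is constructed
here; nothing here says that HC / HC_CM / HC_AV holds; no Literature fact is declared or used.  This file only ASSEMBLES: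
th-7's model theorems (`Wedge.Weil.weilRank`, `weilRank_nn`, `weilRank_deg`, `weilRank_nn_deg`, `weilRank_one`, `weilRank_nn_one`; theory/FORMULA-N-th7.md PART B
§L.3 / §L.8 + the one-sided PART R3, kernel files `WedgeWeil*.lean`) composed with the transport lemmas `WeilCarrier.finrank_S_eq_model(_one)` of
`WedgeWeilCarrier.lean`.  The geometric dictionary (Weil-type abelian `2n`-fold, `K`-eigenspace blocks, Weil vectors, polarisation)
is NOT asserted in Lean; see `ContractionRankWeil.lean` for the real-carrier form with the frame as a named hypothesis.
References: [BourbakiAlgebre1a3] Ch. III §7, §11 no. 9; [BuchweitzFlenner2008HH] Prop. 6.4.4 (why these operators).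
-/

open Module Set Set.powersetCard

namespace Summit.Ventures.HSemireg.WeilCarrier

open Summit.Ventures.HSemireg.WedgeBridge Summit.Ventures.HSemireg.WedgeC15
open Summit.Ventures.HSemireg.Wedge Summit.Ventures.HSemireg.Wedge.Hankel Summit.Ventures.HSemireg.Wedge.Weil

section Signature

variable {K : Type*} [Field K] {N : ℕ} {V : Type*} [AddCommGroup V] [Module K V] (bV : Basis (Fin (N + N)) K V)


/-! ### 5. THEOREM R on the carrier -/

/-- **THEOREM R ON THE CARRIER, degree 2, signature `(p, N - p)`** (`3 ≤ N - p`, `a b ≠ 0`, any `q`, any field):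
`dim S₂(Ecl q N + a·w₊ + b·w₋) + (p+p)((N+N)-(p+p)) = C(N+N, 2) + p(N-p)·rank H₂(q)`, i.e.
`rank = C(2N,2) - (4 - ρ)·p(N - p)` (th-7's `Wedge.Weil.weilRank` transported).
[cite: BuchweitzFlenner2008HH, Prop. 6.4.4] -/
theorem finrank_S_weil {p : ℕ} (hNp : 3 ≤ N - p) (q : ℕ → K) {a b : K} (ha : a ≠ 0) (hb : b ≠ 0) :
    Module.finrank K (S K (Lsp bV) 2 (Ecl bV q N + a • wUp bV p + b • wLow bV p)) + (p + p) * ((N + N) - (p + p)) =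
      (N + N).choose 2 + p * (N - p) * (hankel1 K N 2 q).rank := by
  obtain ⟨a', b', ha', hb', h⟩ := finrank_S_eq_model bV (p := p) (by omega) q a b 2
  rw [h]
  exact weilRank K hNp q (ha' ha) (hb' hb)

/-- **THEOREM R for the TREE's `ContractionSpan.span ↑L ↑(Ann L) x` literally** (degree 2, signature `(p, N - p)`).
[cite: BuchweitzFlenner2008HH, Prop. 6.4.4] [cite: BourbakiAlgebre1a3, Ch. III §11 no. 9] -/
theorem finrank_contractionSpan_weil {p : ℕ} (hNp : 3 ≤ N - p) (q : ℕ → K) {a b : K} (ha : a ≠ 0) (hb : b ≠ 0) :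
    Module.finrank K (Summit.Ventures.HSemireg.ContractionSpan.span (Lsp bV : Set V)
        ((Lsp bV).dualAnnihilator : Set (Module.Dual K V)) (Ecl bV q N + a • wUp bV p + b • wLow bV p)) +
        (p + p) * ((N + N) - (p + p)) =
      (N + N).choose 2 + p * (N - p) * (hankel1 K N 2 q).rank := by
  rw [← S_two_eq]
  exact finrank_S_weil bV hNp q ha hb

/-- **THEOREM R ON THE CARRIER IN EVERY DEGREE `m`, `1 ≤ m < N - p`** (th-7's `weilRank_deg` transported):
`dim S_m + (C(p,m) + C(N-p,m))·ρ_m = C(2p,m) + C(2(N-p),m) + C(N,m)·ρ_m`, `ρ_m = rank H_m(q)`.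
[cite: BuchweitzFlenner2008HH, Prop. 6.4.4] -/
theorem finrank_S_weil_deg {m p : ℕ} (hm1 : 1 ≤ m) (hm : m + 1 ≤ N - p) (q : ℕ → K) {a b : K} (ha : a ≠ 0)
    (hb : b ≠ 0) :
    Module.finrank K (S K (Lsp bV) m (Ecl bV q N + a • wUp bV p + b • wLow bV p)) +
        (p.choose m + (N - p).choose m) * (hankel1 K N m q).rank =
      (p + p).choose m + ((N + N) - (p + p)).choose m + N.choose m * (hankel1 K N m q).rank := by
  obtain ⟨a', b', ha', hb', h⟩ := finrank_S_eq_model bV (p := p) (by omega) q a b m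
  rw [h]
  exact weilRank_deg K hm1 hm q (ha' ha) (hb' hb)

/-- **THEOREM R ON THE CARRIER, ONE-SIDED** (`v = f + a·w₊`, `a ≠ 0`, every degree `m` with `m + 1 ≤ N - p`; th-7's
`weilRank_one` transported): `dim S_m + C(p,m)·ρ_m = C(2p,m) + C(N,m)·ρ_m`. [cite: BuchweitzFlenner2008HH, Prop. 6.4.4] -/
theorem finrank_S_weil_one {m p : ℕ} (hm : m + 1 ≤ N - p) (q : ℕ → K) {a : K} (ha : a ≠ 0) :
    Module.finrank K (S K (Lsp bV) m (Ecl bV q N + a • wUp bV p)) + p.choose m * (hankel1 K N m q).rank =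
      (p + p).choose m + N.choose m * (hankel1 K N m q).rank := by
  obtain ⟨a', ha', h⟩ := finrank_S_eq_model_one bV (p := p) (by omega) q a m
  rw [h]
  exact weilRank_one K hm q (ha' ha)

/-- the one-sided case in degree 2 for the TREE's `ContractionSpan.span ↑L ↑(Ann L) x` literally (`3 ≤ N - p`).
[cite: BuchweitzFlenner2008HH, Prop. 6.4.4] [cite: BourbakiAlgebre1a3, Ch. III §11 no. 9] -/
theorem finrank_contractionSpan_weil_one {p : ℕ} (hNp : 3 ≤ N - p) (q : ℕ → K) {a : K} (ha : a ≠ 0) :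
    Module.finrank K (Summit.Ventures.HSemireg.ContractionSpan.span (Lsp bV : Set V)
        ((Lsp bV).dualAnnihilator : Set (Module.Dual K V)) (Ecl bV q N + a • wUp bV p)) +
        p.choose 2 * (hankel1 K N 2 q).rank =
      (p + p).choose 2 + N.choose 2 * (hankel1 K N 2 q).rank := by
  rw [← S_two_eq]
  exact finrank_S_weil_one bV (m := 2) (by omega) q ha

end Signature

/-! ### 6. Weil type `(n, n)`: the forms quoted in STRUCTURE.md D9 / FORMULA-N (F1) -/

section WeilType

variable {K : Type*} [Field K] {n : ℕ} {V : Type*} [AddCommGroup V] [Module K V]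
  (bV : Basis (Fin ((n + n) + (n + n))) K V)

/-- **THEOREM R (Weil type `(n, n)`, `n ≥ 3`) ON THE CARRIER:** for an adapted basis of a `4n`-dimensional `V`
(`L = span ℓ` of dimension `2n`), `dim S₂(Ecl q (2n) + a·w₊ + b·w₋) + 2n = 4n² + n²·rank H₂(q)`, i.e.
`rank(⌟v ∣ HT²) = (4 + ρ)n² - 2n` (th-7's `Wedge.Weil.weilRank_nn` transported; gs-eng-1 WEIL-CONE-RANK 60/60,
th-6 fn_thmR 56/56, th-7 fn2 78/80 are instances). [cite: BuchweitzFlenner2008HH, Prop. 6.4.4] -/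
theorem finrank_S_weil_nn (hn : 3 ≤ n) (q : ℕ → K) {a b : K} (ha : a ≠ 0) (hb : b ≠ 0) :
    Module.finrank K (S K (Lsp bV) 2 (Ecl bV q (n + n) + a • wUp bV n + b • wLow bV n)) + 2 * n =
      4 * (n * n) + n * n * (hankel1 K (n + n) 2 q).rank := by
  obtain ⟨a', b', ha', hb', h⟩ := finrank_S_eq_model bV (p := n) (by omega) q a b 2
  rw [h]
  exact weilRank_nn K hn q (ha' ha) (hb' hb)

/-- **THEOREM R (Weil type) for the TREE's `ContractionSpan.span ↑L ↑(Ann L) x` literally:**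
`dim span + 2n = 4n² + n²·ρ`. [cite: BuchweitzFlenner2008HH, Prop. 6.4.4] [cite: BourbakiAlgebre1a3, Ch. III §11 no. 9] -/
theorem finrank_contractionSpan_weil_nn (hn : 3 ≤ n) (q : ℕ → K) {a b : K} (ha : a ≠ 0) (hb : b ≠ 0) :
    Module.finrank K (Summit.Ventures.HSemireg.ContractionSpan.span (Lsp bV : Set V)
        ((Lsp bV).dualAnnihilator : Set (Module.Dual K V)) (Ecl bV q (n + n) + a • wUp bV n + b • wLow bV n)) + 2 * n =
      4 * (n * n) + n * n * (hankel1 K (n + n) 2 q).rank := by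
  rw [← S_two_eq]
  exact finrank_S_weil_nn bV hn q ha hb

/-- **THEOREM R in every degree, Weil type `(n, n)`, `1 ≤ m < n`** (th-7's `weilRank_nn_deg` transported):
`dim S_m + 2·C(n,m)·ρ_m = 2·C(2n,m) + C(2n,m)·ρ_m` — STRUCTURE C16's `HT¹` entry `4n` at `m = 1`, `q`-free.
[cite: BuchweitzFlenner2008HH, Prop. 6.4.4] -/
theorem finrank_S_weil_nn_deg {m : ℕ} (hm1 : 1 ≤ m) (hmn : m + 1 ≤ n) (q : ℕ → K) {a b : K} (ha : a ≠ 0)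
    (hb : b ≠ 0) :
    Module.finrank K (S K (Lsp bV) m (Ecl bV q (n + n) + a • wUp bV n + b • wLow bV n)) +
        (n.choose m + n.choose m) * (hankel1 K (n + n) m q).rank =
      (n + n).choose m + (n + n).choose m + (n + n).choose m * (hankel1 K (n + n) m q).rank := by
  obtain ⟨a', b', ha', hb', h⟩ := finrank_S_eq_model bV (p := n) (by omega) q a b m
  rw [h]
  exact weilRank_nn_deg K hm1 hmn q (ha' ha) (hb' hb)

/-- **one-sided, Weil type `(n, n)`, `m + 1 ≤ n`** (th-7's `weilRank_nn_one` transported):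
`dim S_m + C(n,m)·ρ_m = C(2n,m) + C(2n,m)·ρ_m`. [cite: BuchweitzFlenner2008HH, Prop. 6.4.4] -/
theorem finrank_S_weil_nn_one {m : ℕ} (hmn : m + 1 ≤ n) (q : ℕ → K) {a : K} (ha : a ≠ 0) :
    Module.finrank K (S K (Lsp bV) m (Ecl bV q (n + n) + a • wUp bV n)) + n.choose m * (hankel1 K (n + n) m q).rank =
      (n + n).choose m + (n + n).choose m * (hankel1 K (n + n) m q).rank := by
  obtain ⟨a', ha', h⟩ := finrank_S_eq_model_one bV (p := n) (by omega) q a m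
  rw [h]
  exact weilRank_nn_one K hmn q (ha' ha)

end WeilType

end Summit.Ventures.HSemireg.WeilCarrier
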